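import Summits.AnomalousDissipation.AnomalousDissipation.Theses.LoudWindows
import Literature.Analysis.FunctionSpaces.TorusTrigPoly
import Literature.Analysis.FunctionSpaces.TorusVectorParseval
import Literature.Analysis.FluidPDE.StatisticalSolutionEnergyEq
import Literature.Analysis.FluidPDE.CylindricalGenerator
import Literature.Analysis.FluidPDE.LerayHopfTimeSliceTorus
import HarnessLib

/-!
# Route LoudWindows — support `WeakDuality`, part 1: the grammar-B bracket on rough slices

A grammar-B certificate inequality assumed at every SMOOTH divergence-free field extends to every
`L²` weakly divergence-free field of finite enstrophy (the a.e. time slices of a Leray–Hopf solution):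
approximate by the Fourier truncations `P_N v` (smooth, divergence free), along which every term of
the bracket converges — the pairings and the inertial term by norm-continuity on `L²`, the energy by
Parseval, the enstrophy by monotone convergence of the spectral partial sums, the profile
derivative `∂ᵢφ` by continuity (`φ ∈ C¹`).

Decomposition cell `decomp-ad`, lens-3 lineage g61 (route LoudWindows, item
stmt-AnomalousDissipation-28927).

[folklore] [cite: FoiasManleyRosaTemam2001, Ch. IV §1.2] [cite: RobinsonRodrigoSadowski2016, Lemma 4.1]
-/

noncomputable section

open MeasureTheory Filter Topology Set UnitAddTorus
open scoped ENNReal NNReal RealInnerProductSpace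

namespace Summit.AnomalousDissipation.AnomalousDissipation.Theorems

open Literature.Analysis.FluidPDE Literature.Analysis.FunctionSpaces

set_option linter.dupNamespace false

variable {d : Type*} [Fintype d] [DecidableEq d]

omit [DecidableEq d] in
/-- An `L²` pairing `∫⟪w, h⟫` read on the `L²` classes. [folklore] -/
theorem weakDuality_integral_inner_eq_inner_toLp {w h : UnitAddTorus d → EuclideanSpace ℝ d}
    (hw : MemLp w 2 volume) (hh : MemLp h 2 volume) :
    ∫ x, ⟪w x, h x⟫ = ⟪hw.toLp w, hh.toLp h⟫ := by
  rw [MeasureTheory.L2.inner_def]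
  refine integral_congr_ae ?_
  filter_upwards [hw.coeFn_toLp, hh.coeFn_toLp] with x hx hy
  rw [hx, hy]

omit [DecidableEq d] in
/-- The convective pairing `∫⟪w, (w·∇)g⟫` read on the `L²` class is the inertial pairing. [folklore] -/
theorem weakDuality_integral_inner_convect_eq_inertialPairing {w g : UnitAddTorus d → EuclideanSpace ℝ d}
    (hw : MemLp w 2 volume) :
    ∫ x, ⟪w x, Torus.convect w g x⟫ = Torus.inertialPairing (hw.toLp w) g := by
  unfold Torus.inertialPairing
  refine integral_congr_ae ?_
  filter_upwards [hw.coeFn_toLp] with x hx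
  simp only [hx, Torus.convect]
  exact real_inner_comm _ _

/-- Splitting of the flux integral `∫(⟪w,(w·∇)g⟫ + ν⟪w,Δg⟫ + ⟪f,g⟫)`. [folklore] -/
theorem weakDuality_flux_split (ν : ℝ) {f w g : UnitAddTorus d → EuclideanSpace ℝ d}
    (hf : MemLp f 2 volume) (hw : MemLp w 2 volume) (hg : Torus.IsSmooth g) :
    ∫ x, (⟪w x, Torus.convect w g x⟫ + ν * ⟪w x, Torus.laplacian g x⟫ + ⟪f x, g x⟫) =
      (∫ x, ⟪w x, Torus.convect w g x⟫) + ν * (∫ x, ⟪w x, Torus.laplacian g x⟫) + ∫ x, ⟪f x, g x⟫ := by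
  have hi1 : Integrable (fun x => ⟪w x, Torus.convect w g x⟫) volume :=
    Torus.integrable_inner_convect_self hw hg
  have hi2 : Integrable (fun x => ν * ⟪w x, Torus.laplacian g x⟫) volume :=
    (Torus.integrable_inner_of_continuous (hw.integrable one_le_two) hg.laplacian.continuous).const_mul ν
  have hi3 : Integrable (fun x => ⟪f x, g x⟫) volume :=
    Torus.integrable_inner_of_continuous (hf.integrable one_le_two) hg.continuous
  have hi12 : Integrable (fun x => ⟪w x, Torus.convect w g x⟫ + ν * ⟪w x, Torus.laplacian g x⟫) volume :=
    hi1.add hi2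
  rw [integral_add hi12 hi3, integral_add hi1 hi2, integral_const_mul]

/-- **The grammar-B bracket extends from smooth divergence-free fields to rough slices**: if
`λE + [(1+2a)⟨f,w⟩ − λ‖w‖² − 2aν‖∇w‖² + Σᵢ ∂ᵢφ(coords w)·fluxᵢ(w)] ≤ B` for all smooth divergence-free
`w`, then the same holds at every `v ∈ L²`, weakly divergence free, with `‖∇v‖₂ < ∞` (Fourier
truncation `P_N v → v`). [folklore] [cite: RobinsonRodrigoSadowski2016, Lemma 4.1] -/
theorem weakDuality_bracket_of_smooth {ν lam a B E : ℝ} {f v : UnitAddTorus d → EuclideanSpace ℝ d}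
    (hf : MemLp f 2 volume) (Φ : Torus.CylindricalTest d)
    (hcert : ∀ w : UnitAddTorus d → EuclideanSpace ℝ d, Torus.IsSmooth w → Torus.IsDivFree w →
      lam * E + ((1 + 2 * a) * (∫ x, ⟪f x, w x⟫) - lam * (∫ x, ‖w x‖ ^ 2) -
        2 * a * ν * (Torus.eGradNormSq w).toReal +
        ∑ i : Fin Φ.m, fderiv ℝ Φ.φ (WithLp.toLp 2 fun i' => ∫ x, ⟪w x, Φ.g i' x⟫)
          (EuclideanSpace.single i 1) *
          (∫ x, (⟪w x, Torus.convect w (Φ.g i) x⟫ + ν * ⟪w x, Torus.laplacian (Φ.g i) x⟫ +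
            ⟪f x, Φ.g i x⟫))) ≤ B)
    (hv : MemLp v 2 volume) (hdiv : Torus.IsWeaklyDivFree v) (hgrad : Torus.eGradNormSq v ≠ ⊤) :
    lam * E + ((1 + 2 * a) * (∫ x, ⟪f x, v x⟫) - lam * (∫ x, ‖v x‖ ^ 2) -
        2 * a * ν * (Torus.eGradNormSq v).toReal +
        ∑ i : Fin Φ.m, fderiv ℝ Φ.φ (WithLp.toLp 2 fun i' => ∫ x, ⟪v x, Φ.g i' x⟫)
          (EuclideanSpace.single i 1) *
          (∫ x, (⟪v x, Torus.convect v (Φ.g i) x⟫ + ν * ⟪v x, Torus.laplacian (Φ.g i) x⟫ +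
            ⟪f x, Φ.g i x⟫))) ≤ B := by
  classical
  -- the bracket as a function of the field
  set F : (UnitAddTorus d → EuclideanSpace ℝ d) → ℝ := fun w =>
    lam * E + ((1 + 2 * a) * (∫ x, ⟪f x, w x⟫) - lam * (∫ x, ‖w x‖ ^ 2) -
        2 * a * ν * (Torus.eGradNormSq w).toReal +
        ∑ i : Fin Φ.m, fderiv ℝ Φ.φ (WithLp.toLp 2 fun i' => ∫ x, ⟪w x, Φ.g i' x⟫)
          (EuclideanSpace.single i 1) *
          (∫ x, (⟪w x, Torus.convect w (Φ.g i) x⟫ + ν * ⟪w x, Torus.laplacian (Φ.g i) x⟫ +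
            ⟪f x, Φ.g i x⟫))) with hF
  show F v ≤ B
  -- the truncations
  set vN : ℕ → UnitAddTorus d → EuclideanSpace ℝ d := fun N => Torus.fourierTruncate N v with hvN
  have hvN2 : ∀ N, MemLp (vN N) 2 volume := fun N => Torus.memLp_fourierTruncate N v 2
  have hB : ∀ N, F (vN N) ≤ B := fun N =>
    hcert (vN N) (Torus.isSmooth_fourierTruncate N v) (Torus.isDivFree_fourierTruncate hv hdiv N)
  -- `P_N v → v` in `L²`
  set V : ℕ → Lp (EuclideanSpace ℝ d) 2 (volume : Measure (UnitAddTorus d)) :=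
    fun N => (hvN2 N).toLp (vN N) with hV
  set Vi : Lp (EuclideanSpace ℝ d) 2 (volume : Measure (UnitAddTorus d)) := hv.toLp v with hVi
  have hVt : Tendsto V atTop (𝓝 Vi) := by
    rw [Lp.tendsto_Lp_iff_tendsto_eLpNorm']
    refine (Torus.tendsto_eLpNorm_fourierTruncate_sub hv).congr fun N => ?_
    exact (eLpNorm_congr_ae (((hvN2 N).coeFn_toLp).sub hv.coeFn_toLp)).symm
  -- pairings with a fixed `L²` field converge
  have hpair : ∀ {h : UnitAddTorus d → EuclideanSpace ℝ d}, MemLp h 2 volume →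
      Tendsto (fun N => ∫ x, ⟪vN N x, h x⟫) atTop (𝓝 (∫ x, ⟪v x, h x⟫)) := by
    intro h hh
    have ht : Tendsto (fun N => ⟪V N, hh.toLp h⟫) atTop (𝓝 ⟪Vi, hh.toLp h⟫) :=
      hVt.inner tendsto_const_nhds
    rw [← weakDuality_integral_inner_eq_inner_toLp hv hh] at ht
    exact ht.congr fun N => (weakDuality_integral_inner_eq_inner_toLp (hvN2 N) hh).symm
  -- the power term
  have hpow : Tendsto (fun N => ∫ x, ⟪f x, vN N x⟫) atTop (𝓝 (∫ x, ⟪f x, v x⟫)) := by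
    have e : ∀ w : UnitAddTorus d → EuclideanSpace ℝ d, (∫ x, ⟪f x, w x⟫) = ∫ x, ⟪w x, f x⟫ :=
      fun w => integral_congr_ae (ae_of_all _ fun x => real_inner_comm _ _)
    simp only [e]
    exact hpair hf
  -- the energy term (Parseval)
  have hnorm : Tendsto (fun N => ∫ x, ‖vN N x‖ ^ 2) atTop (𝓝 (∫ x, ‖v x‖ ^ 2)) := by
    have hs := (Torus.hasSum_sq_norm_mFourierCoeff_complexify hv).comp Torus.tendsto_freqBall_atTop
    exact hs.congr fun N => (Torus.integral_norm_sq_fourierTruncate (hv.integrable one_le_two) N).symm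
  -- the enstrophy term (monotone convergence of the spectral partial sums; finite limit)
  have hgradT : Tendsto (fun N => (Torus.eGradNormSq (vN N)).toReal) atTop
      (𝓝 (Torus.eGradNormSq v).toReal) := by
    have hsum := (ENNReal.summable (f := fun k : d → ℤ =>
      ENNReal.ofReal (Torus.freqNormSq k) *
        ‖mFourierCoeff (EuclideanSpace.complexify ∘ v) k‖ₑ ^ 2)).hasSum
    have h := ENNReal.Tendsto.const_mul (hsum.comp Torus.tendsto_freqBall_atTop)
      (Or.inr (ENNReal.ofReal_ne_top (r := 4 * Real.pi ^ 2)))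
    rw [← Torus.eGradNormSq_eq_tsum] at h
    have h' : Tendsto (fun N => Torus.eGradNormSq (vN N)) atTop (𝓝 (Torus.eGradNormSq v)) :=
      h.congr fun N => (Torus.eGradNormSq_fourierTruncate_eq_sum (hv.integrable one_le_two) N).symm
    exact (ENNReal.tendsto_toReal hgrad).comp h'
  -- the inertial term (norm-continuous quadratic form on `L²`)
  have hinert : ∀ i : Fin Φ.m, Tendsto (fun N => ∫ x, ⟪vN N x, Torus.convect (vN N) (Φ.g i) x⟫) atTop
      (𝓝 (∫ x, ⟪v x, Torus.convect v (Φ.g i) x⟫)) := by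
    intro i
    have hc := ((Torus.continuous_inertialPairing (Φ.g_smooth i)).tendsto Vi).comp hVt
    rw [show Torus.inertialPairing Vi (Φ.g i) = ∫ x, ⟪v x, Torus.convect v (Φ.g i) x⟫ from
      (weakDuality_integral_inner_convect_eq_inertialPairing hv).symm] at hc
    exact hc.congr fun N => (weakDuality_integral_inner_convect_eq_inertialPairing (hvN2 N)).symm
  -- the flux of each test field
  have hflux : ∀ i : Fin Φ.m, Tendsto (fun N => ∫ x, (⟪vN N x, Torus.convect (vN N) (Φ.g i) x⟫ +
      ν * ⟪vN N x, Torus.laplacian (Φ.g i) x⟫ + ⟪f x, Φ.g i x⟫)) atTop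
      (𝓝 (∫ x, (⟪v x, Torus.convect v (Φ.g i) x⟫ + ν * ⟪v x, Torus.laplacian (Φ.g i) x⟫ +
        ⟪f x, Φ.g i x⟫))) := by
    intro i
    rw [weakDuality_flux_split ν hf hv (Φ.g_smooth i)]
    refine (((hinert i).add ((hpair ((Φ.g_smooth i).laplacian.memLp 2)).const_mul ν)).add
      tendsto_const_nhds).congr fun N => ?_
    exact (weakDuality_flux_split ν hf (hvN2 N) (Φ.g_smooth i)).symm
  -- the profile derivatives (continuity of `∂ᵢφ`, `φ ∈ C¹`)
  have hcoef : ∀ i : Fin Φ.m, Tendsto (fun N => fderiv ℝ Φ.φ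
      (WithLp.toLp 2 fun i' => ∫ x, ⟪vN N x, Φ.g i' x⟫) (EuclideanSpace.single i 1)) atTop
      (𝓝 (fderiv ℝ Φ.φ (WithLp.toLp 2 fun i' => ∫ x, ⟪v x, Φ.g i' x⟫) (EuclideanSpace.single i 1))) := by
    intro i
    have hco : Tendsto (fun N => (WithLp.toLp 2 fun i' => ∫ x, ⟪vN N x, Φ.g i' x⟫ :
        EuclideanSpace ℝ (Fin Φ.m))) atTop (𝓝 (WithLp.toLp 2 fun i' => ∫ x, ⟪v x, Φ.g i' x⟫)) := by
      refine ((PiLp.continuous_toLp 2 _).tendsto _).comp ?_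
      exact tendsto_pi_nhds.2 fun i' => hpair ((Φ.g_smooth i').memLp 2)
    have hφc : Continuous fun z : EuclideanSpace ℝ (Fin Φ.m) =>
        fderiv ℝ Φ.φ z (EuclideanSpace.single i 1) :=
      (Φ.φ_contDiff.continuous_fderiv one_ne_zero).clm_apply continuous_const
    exact (hφc.tendsto _).comp hco
  -- assemble
  have hT : Tendsto (fun N => F (vN N)) atTop (𝓝 (F v)) := by
    simp only [hF]
    exact tendsto_const_nhds.add
      ((((tendsto_const_nhds.mul hpow).sub (tendsto_const_nhds.mul hnorm)).sub
        (tendsto_const_nhds.mul hgradT)).add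
        (tendsto_finsetSum _ fun i _ => (hcoef i).mul (hflux i)))
  exact le_of_tendsto' hT hB

end Summit.AnomalousDissipation.AnomalousDissipation.Theorems

end
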